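import Literature.AlgebraicGeometry.Resolution.Kuhlmann2019Lemma42NormalForm
import Literature.AlgebraicGeometry.Resolution.SplitApproximationType
import Literature.AlgebraicGeometry.Resolution.DeeplyRamifiedSplit
import HarnessLib

/-!
# Kuhlmann 2019, Lemma 4.2 and Prop. 4.8 over perfect ground fields inside a split extension

Topic: `Literature/AlgebraicGeometry/Resolution` (valued function fields). The degree-`p` step
of the henselian-rationality theorem of F.-V. Kuhlmann, *Elimination of ramification II:
Henselian rationality*, Israel J. Math. 234 (2019) 927–958 = arXiv:1701.05508, §4 — proved in the
tree for SEPARABLY CLOSED ground fields (`Kuhlmann2019Lemma42PElimination.lean`,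
`Kuhlmann2019Lemma42NormalForm.lean`, `Kuhlmann2019Prop48Setup.lean`,
`Kuhlmann2019DegreePStepAssembly.lean`) — re-run under the hypotheses available in M. Temkin,
*Inseparable local uniformization*, J. Algebra 373 (2013) = arXiv:0804.1554, Thm. 3.2.3 (and
[temst] = M. Temkin, *Stable modification of relative curves*, J. Algebraic Geom. 19 (2010),
Thm. 6.3.1 (ii)): the ground field `K` is PERFECT ("deeply ramified"), henselian of rank one, and
the function field is `K`-SPLIT (`K` is algebraically closed in it). The printed proofs use
separable closedness of `K` at exactly three places, each of which has a replacement here: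

1. the transcendental approximation type of the generator `z` (Lemma 4.6 there; §4.1 standing
   assumption) — from splitness, `kaplansky_condition_of_split` (`SplitApproximationType.lean`);
2. the density of `K` in its perfect hull (last paragraph of the proof of Lemma 4.2) — trivial
   for perfect `K` (`dense_of_perfect`);
3. the case of a CONSTANT Artin–Schreier normal form `ϑ'^p − ϑ' = a₀ ∈ K` in the proof of
   Prop. 4.8, where `ϑ'` must be shown to lie in `K` — `ϑ'` is an element of the step `E`
   algebraic over `K`, and `K` is algebraically closed in `E` (splitness; cf. the end of the
   proof of [temst] Thm. 6.3.1: "`α` approximates a root of `T^p − aT + b = 0` better than any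
   element from `k` … would contradict our assumption that `L` is `k`-split").

The statements and proofs are otherwise those of the tree files, with `[IsSepClosed K]` replaced
by the hypotheses actually used (`hdense`, `h3`, `hrel`); the originals are the special cases
`K` separably closed.

## Content (everything PROVED; no definitions, no named facts)

* `exists_pElimination_of_dense`, `dense_of_perfect` — elimination of the `p`-divisible indices
  (proof of Lemma 4.2) for `K` dense in its perfect hull [cite: Kuhlmann2019, Lemma 4.2 (proof)].
* `lemma42_normalForm_of_kaplansky` — **Lemma 4.2 (`(H42)`)** for such `K` and `z` of
  transcendental approximation type [cite: Kuhlmann2019, Lemma 4.2].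
* `exists_artinSchreier_generator_eval_of_kaplansky` — (4.3) [cite: Kuhlmann2019, Section 4, (4.3)].
* `prop48_of_kaplansky` — **Prop. 4.8** from `h3`, `(H42)` and "`K` algebraically closed in `E`"
  [cite: Kuhlmann2019, Prop. 4.8].
* `prop48_of_perfect` — **the degree-`p` step over a perfect henselian `K` of rank one inside a
  henselian `Φ ⊇ K(z)` in which `K` is algebraically closed** (Temkin 2013, Cor. 3.1.10 supplies
  splitness, `DeeplyRamifiedSplit.lean`) [cite: Kuhlmann2019, Prop. 4.8]
  [cite: Temkin2013, Thm. 3.2.3 (proof, Step 1)].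

## Sources

* F.-V. Kuhlmann, Israel J. Math. 234 (2019) = arXiv:1701.05508: §4, (4.3), Lemmas 4.1, 4.2,
  4.6, 4.7, Prop. 4.8 (pp. 8–11 of the arXiv text). [Kuhlmann2019]
* M. Temkin, J. Algebra 373 (2013) = arXiv:0804.1554: Cor. 3.1.10, Thm. 3.2.3. [Temkin2013]
* M. Temkin, J. Algebraic Geom. 19 (2010) = arXiv:0707.3953: Assumption 6.2.1, Thm. 6.3.1 and its
  proof (p. 38 of the arXiv text).

## Rendering notes

As in the four tree files named above (ambient `(Ω, V)`, `K(z) = Subfield.closure (K ∪ {z})`,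
`K(z)^h = henselization V K(z)`, Galois steps `IsGaloisStep`, multiplicative values).
-/

noncomputable section

namespace Literature.AlgebraicGeometry.Resolution

universe u

open Polynomial IsLocalRing IntermediateField

variable {Ω : Type u} [Field Ω] (V : ValuationSubring Ω)

/-! ### Elimination of the `p`-divisible indices over a ground field dense in its perfect hull -/

section Elimination

variable {p : ℕ} [Fact p.Prime] [CharP Ω p] [PerfectRing Ω p]

/-- **Elimination of the `p`-divisible indices modulo `℘(F)` — `exists_pElimination`
(`Kuhlmann2019Lemma42PElimination.lean`, Kuhlmann 2019, proof of Lemma 4.2) with the ground field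
`K` only assumed DENSE IN ITS PERFECT HULL** (every `y` with `y^{p^n} ∈ K` is approximated by
elements of `K` to within any value of `K^×`) instead of separably closed; this covers perfect
`K` (the case "If `(K,v)` is perfect … we may assume that `K′ = K`" of Lemma 4.2) as well as
separably tame `K` ([17, Cor. 3.12]). Same statement otherwise, same proof: the approximants
`βᵢ` of `bᵢ^{1/p^ν}` and `g_j` of `S_j` come from the density hypothesis; the auxiliary bound of
value `≤ min(1, v(S_j))` is `1` or `S_j^{p^D} ∈ K` (no divisibility of `vK` needed).
[cite: Kuhlmann2019, Lemma 4.2 (proof)] -/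
theorem exists_pElimination_of_dense {K F : Subfield Ω} (hKF : K ≤ F)
    (hdense : ∀ (y : Ω) (n : ℕ), y ^ p ^ n ∈ K → ∀ b ∈ K, b ≠ 0 →
      ∃ β ∈ K, V.valuation (y - β) < V.valuation b)
    (hF : HenselianLocalRing (V.comap (algebraMap F Ω)))
    {zt : Ω} (hztF : zt ∈ F) (hzt : V.valuation zt ≤ 1)
    {B : Polynomial Ω} (hB : ∀ k, B.coeff k ∈ K) {D : ℕ} (hD : B.natDegree ≤ D) :
    ∃ g : Polynomial Ω, (∀ k, g.coeff k ∈ K) ∧ g.coeff 0 = B.coeff 0 ∧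
      (∃ d ∈ F, B.eval zt - g.eval zt = d ^ p - d) ∧
      (∀ i, 0 < i → p ∣ i → g.coeff i = 0) ∧
      (∀ j, 0 < j → ¬ p ∣ j → (pRootSum p B D j = 0 → g.coeff j = 0) ∧
        (pRootSum p B D j ≠ 0 → V.valuation (g.coeff j) = V.valuation (pRootSum p B D j))) := by
  classical
  have hp : p.Prime := Fact.out
  have hztpow : ∀ k : ℕ, V.valuation (zt ^ k) ≤ 1 := fun k => by
    rw [map_pow]; exact pow_le_one₀ zero_le hzt
  -- notation
  set ν : ℕ → ℕ := fun i => i.factorization p with hνdef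
  set jj : ℕ → ℕ := fun i => pFreePart p i with hjjdef
  set r : ℕ → Ω := fun i => (iterateFrobeniusEquiv Ω p (ν i)).symm (B.coeff i) with hrdef
  have hr : ∀ i, r i ^ p ^ ν i = B.coeff i := fun i => iterateFrobeniusEquiv_symm_pow (ν i) _
  have hdecomp : ∀ i, p ^ ν i * jj i = i := fun i => pow_factorization_mul_pFreePart i
  ---------------------------------------------------------------- Step 1: `βᵢ ∈ K` near `rᵢ`
  have hβ : ∀ i, ∃ β ∈ K, V.valuation (r i - β) < 1 := by
    intro i
    have hy : r i ^ p ^ ν i ∈ K := by rw [hr i]; exact hB i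
    have h := hdense (r i) (ν i) hy 1 K.one_mem one_ne_zero
    rwa [map_one] at h
  choose β hβK hβ using hβ
  ---------------------------------------------------------------- Step 2: per-index congruence
  have hstep : ∀ i, 0 < i → ∃ d ∈ F, B.coeff i * zt ^ i - β i * zt ^ jj i = d ^ p - d := by
    intro i hi
    have hy : β i * zt ^ jj i ∈ F := mul_mem (hKF (hβK i)) (pow_mem hztF _)
    have hpow : (zt ^ jj i) ^ p ^ ν i = zt ^ i := by rw [← pow_mul, mul_comm, hdecomp i]
    -- `bᵢ − βᵢ^{p^ν} = (rᵢ − βᵢ)^{p^ν}` is small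
    have hsmall : V.valuation ((B.coeff i - β i ^ p ^ ν i) * zt ^ i) < 1 := by
      have h1 : B.coeff i - β i ^ p ^ ν i = (r i - β i) ^ p ^ ν i := by
        rw [sub_pow_char_pow, hr i]
      rw [map_mul, h1, map_pow]
      calc V.valuation (r i - β i) ^ p ^ ν i * V.valuation (zt ^ i)
          ≤ V.valuation (r i - β i) ^ p ^ ν i * 1 := by gcongr; exact hztpow i
        _ < 1 := by
          rw [mul_one]
          exact pow_lt_one₀ zero_le (hβ i) (pow_ne_zero _ hp.ne_zero)
    have hmF : (B.coeff i - β i ^ p ^ ν i) * zt ^ i ∈ F :=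
      mul_mem (sub_mem (hKF (hB i)) (pow_mem (hKF (hβK i)) _)) (pow_mem hztF _)
    obtain ⟨d₂, hd₂F, hd₂, -⟩ := exists_artinSchreierRoot_of_valuation_lt_one hF hmF hsmall
    obtain ⟨d₁, hd₁F, hd₁⟩ := exists_pow_sub_self_pow_pow_sub (p := p) hy (ν i)
    have hsplit : B.coeff i * zt ^ i - β i * zt ^ jj i =
        ((β i * zt ^ jj i) ^ p ^ ν i - β i * zt ^ jj i) + (B.coeff i - β i ^ p ^ ν i) * zt ^ i := by
      rw [mul_pow, hpow]
      ring
    rw [hsplit]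
    exact exists_pow_sub_self_add ⟨d₁, hd₁F, hd₁⟩ ⟨d₂, hd₂F, hd₂.symm⟩
  ---------------------------------------------------------------- Step 3: approximants `e_j ∈ K` of `S_j`
  set S : ℕ → Ω := fun j => pRootSum p B D j with hSdef
  have hSpow : ∀ j, S j ^ p ^ D ∈ K := by
    intro j
    rw [hSdef]
    simp only
    rw [pRootSum_pow]
    exact sum_mem fun i _ => pow_mem (hB i) _
  have he : ∀ j, ∃ e ∈ K, (S j = 0 → e = 0) ∧ V.valuation (S j - e) < 1 ∧
      (S j ≠ 0 → V.valuation (S j - e) < V.valuation (S j)) := by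
    intro j
    by_cases hS0 : S j = 0
    · refine ⟨0, K.zero_mem, fun _ => rfl, ?_, fun h => (h hS0).elim⟩
      rw [hS0, sub_zero, map_zero]
      exact zero_lt_one
    · -- a bound `b ∈ K^×` with `v(b) ≤ min(1, v(S_j))`: `1` if `v(S_j) ≥ 1`, else `S_j^{p^D}`
      have hSD0 : S j ^ p ^ D ≠ 0 := pow_ne_zero _ hS0
      obtain ⟨b, hbK, hb0, hb1, hba⟩ : ∃ b ∈ K, b ≠ 0 ∧ V.valuation b ≤ 1 ∧
          V.valuation b ≤ V.valuation (S j) := by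
        by_cases hle : 1 ≤ V.valuation (S j)
        · exact ⟨1, K.one_mem, one_ne_zero, by rw [map_one], by rw [map_one]; exact hle⟩
        · push Not at hle
          have hpD : p ^ D ≠ 0 := pow_ne_zero _ hp.ne_zero
          have hpow : V.valuation (S j ^ p ^ D) ≤ V.valuation (S j) := by
            rw [map_pow]
            exact pow_le_of_le_one zero_le hle.le hpD
          exact ⟨S j ^ p ^ D, hSpow j, hSD0, hpow.trans hle.le, hpow⟩
      obtain ⟨e, heK, he⟩ := hdense (S j) D (hSpow j) b hbK hb0
      exact ⟨e, heK, fun h => (hS0 h).elim, lt_of_lt_of_le he hb1, fun _ => lt_of_lt_of_le he hba⟩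
  choose e heK he0 he1 he2 using he
  ---------------------------------------------------------------- Step 4: the polynomial `g`
  set J : Finset ℕ := pFreeIndices p D with hJdef
  set P : Finset ℕ := posIndices D with hPdef
  set g : Polynomial Ω := C (B.coeff 0) + ∑ j ∈ J, C (e j) * X ^ j with hgdef
  have hgcoeff : ∀ n, g.coeff n = (if n = 0 then B.coeff 0 else 0) + (if n ∈ J then e n else 0) := by
    intro n
    rw [hgdef, coeff_add, coeff_C, finsetSum_coeff]
    congr 1
    have h1 : ∀ j ∈ J, (C (e j) * X ^ j).coeff n = if n = j then e j else 0 := by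
      intro j _
      rw [coeff_C_mul, coeff_X_pow, mul_ite, mul_one, mul_zero]
    rw [Finset.sum_congr rfl h1, Finset.sum_ite_eq]
  have h0J : (0 : ℕ) ∉ J := fun h => by
    have := (mem_pFreeIndices_iff.mp h).1.1
    exact lt_irrefl 0 this
  have hg0 : g.coeff 0 = B.coeff 0 := by
    rw [hgcoeff, if_pos rfl, if_neg h0J, add_zero]
  have hgJ : ∀ j ∈ J, g.coeff j = e j := by
    intro j hj
    have hj0 : j ≠ 0 := (mem_pFreeIndices_iff.mp hj).1.1.ne'
    rw [hgcoeff, if_neg hj0, if_pos hj, zero_add]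
  have hgnotJ : ∀ n, n ≠ 0 → n ∉ J → g.coeff n = 0 := by
    intro n hn hnJ
    rw [hgcoeff, if_neg hn, if_neg hnJ, add_zero]
  refine ⟨g, ?_, hg0, ?_, ?_, ?_⟩
  · -- coefficients in `K`
    intro n
    rw [hgcoeff]
    refine add_mem ?_ ?_
    · split_ifs
      · exact hB 0
      · exact K.zero_mem
    · split_ifs
      · exact heK n
      · exact K.zero_mem
  · ---------------------------------------------------------------- Step 5: the congruence
    -- `B(z̃) = b₀ + ∑_{i ∈ P} bᵢ z̃^i`, `g(z̃) = b₀ + ∑_{j ∈ J} e_j z̃^j`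
    have hBeval : B.eval zt = B.coeff 0 + ∑ i ∈ P, B.coeff i * zt ^ i := by
      rw [eval_eq_sum_range' (lt_of_le_of_lt hD (Nat.lt_succ_self D)), hPdef]
      unfold posIndices
      rw [← Finset.sum_filter_add_sum_filter_not (Finset.range (D + 1)) (fun i => 0 < i), add_comm]
      congr 1
      have hflt : (Finset.range (D + 1)).filter (fun i => ¬ 0 < i) = {0} := by
        ext i
        simp only [Finset.mem_filter, Finset.mem_range, Finset.mem_singleton, not_lt,
          Nat.le_zero]
        omega
      rw [hflt, Finset.sum_singleton, pow_zero, mul_one]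
    have hgeval : g.eval zt = B.coeff 0 + ∑ j ∈ J, e j * zt ^ j := by
      rw [hgdef, eval_add, eval_C, eval_finsetSum]
      congr 1
      refine Finset.sum_congr rfl fun j _ => ?_
      rw [eval_mul, eval_C, eval_pow, eval_X]
    -- collect the `βᵢ` along the fibres
    have hmaps : ∀ i ∈ P, jj i ∈ J := fun i hi => pFreePart_mem_pFreeIndices hp hi
    have hfib : ∑ i ∈ P, β i * zt ^ jj i = ∑ j ∈ J, (∑ i ∈ pFiber p D j, β i) * zt ^ j := by
      rw [← Finset.sum_fiberwise_of_maps_to hmaps]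
      refine Finset.sum_congr rfl fun j _ => ?_
      rw [Finset.sum_mul]
      refine Finset.sum_congr rfl fun i hi => ?_
      have hij : jj i = j := (Finset.mem_filter.mp hi).2
      rw [hij]
    have hident : B.eval zt - g.eval zt =
        ∑ i ∈ P, (B.coeff i * zt ^ i - β i * zt ^ jj i) +
          ∑ j ∈ J, ((∑ i ∈ pFiber p D j, β i) - e j) * zt ^ j := by
      have h2 : ∑ j ∈ J, ((∑ i ∈ pFiber p D j, β i) - e j) * zt ^ j =
          ∑ j ∈ J, (∑ i ∈ pFiber p D j, β i) * zt ^ j - ∑ j ∈ J, e j * zt ^ j := by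
        rw [← Finset.sum_sub_distrib]
        exact Finset.sum_congr rfl fun j _ => by ring
      rw [h2, Finset.sum_sub_distrib, hfib, hBeval, hgeval]
      ring
    rw [hident]
    refine exists_pow_sub_self_add (exists_pow_sub_self_sum P _ fun i hi => ?_)
      (exists_pow_sub_self_sum J _ fun j hj => ?_)
    · exact hstep i (mem_posIndices_iff.mp hi).1
    · -- `(∑_{fibre} βᵢ − e_j) z̃^j ∈ 𝓜_F ⊆ ℘(F)`
      have hmF : ((∑ i ∈ pFiber p D j, β i) - e j) * zt ^ j ∈ F :=
        mul_mem (sub_mem (sum_mem fun i _ => hKF (hβK i)) (hKF (heK j))) (pow_mem hztF _)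
      have hsmall : V.valuation (((∑ i ∈ pFiber p D j, β i) - e j) * zt ^ j) < 1 := by
        have hsplit : (∑ i ∈ pFiber p D j, β i) - e j =
            ∑ i ∈ pFiber p D j, (β i - r i) + (S j - e j) := by
          rw [Finset.sum_sub_distrib, hSdef]
          unfold pRootSum
          ring
        rw [map_mul]
        calc V.valuation ((∑ i ∈ pFiber p D j, β i) - e j) * V.valuation (zt ^ j)
            ≤ V.valuation ((∑ i ∈ pFiber p D j, β i) - e j) * 1 := by gcongr; exact hztpow j
          _ < 1 := by
            rw [mul_one, hsplit]
            refine lt_of_le_of_lt (V.valuation.map_add _ _) (max_lt ?_ (he1 j))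
            refine V.valuation.map_sum_lt one_ne_zero fun i _ => ?_
            rw [Valuation.map_sub_swap]
            exact hβ i
      obtain ⟨d, hdF, hd, -⟩ := exists_artinSchreierRoot_of_valuation_lt_one hF hmF hsmall
      exact ⟨d, hdF, hd.symm⟩
  · -- no positive index divisible by `p`
    intro i hi hpi
    refine hgnotJ i hi.ne' fun hiJ => ?_
    exact (mem_pFreeIndices_iff.mp hiJ).2 hpi
  · ---------------------------------------------------------------- Step 6: the values
    intro j hj hpj
    by_cases hjD : j ≤ D
    · have hjJ : j ∈ J := mem_pFreeIndices_iff.mpr ⟨⟨hj, hjD⟩, hpj⟩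
      rw [hgJ j hjJ]
      refine ⟨he0 j, fun hS0 => ?_⟩
      have h1 : e j = S j + -(S j - e j) := by ring
      have hlt : V.valuation (-(S j - e j)) < V.valuation (S j) := by
        rw [Valuation.map_neg]
        exact he2 j hS0
      rw [h1, V.valuation.map_add_eq_of_lt_left hlt]
    · push Not at hjD
      have hS0 : pRootSum p B D j = 0 := pRootSum_eq_zero_of_lt hjD
      have hjJ : j ∉ J := fun h => by
        have := (mem_pFreeIndices_iff.mp h).1.2
        omega
      refine ⟨fun _ => hgnotJ j hj.ne' hjJ, fun h => (h hS0).elim⟩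

omit [PerfectRing Ω p] in
/-- A perfect subfield is (trivially) dense in its perfect hull: the hypothesis `hdense` of
`exists_pElimination_of_dense` for `K` in which every element is a `p`-th power. [folklore] -/
theorem dense_of_perfect {K : Subfield Ω} (hperf : ∀ y ∈ K, ∃ b ∈ K, b ^ p = y) :
    ∀ (y : Ω) (n : ℕ), y ^ p ^ n ∈ K → ∀ b ∈ K, b ≠ 0 →
      ∃ β ∈ K, V.valuation (y - β) < V.valuation b := by
  intro y n hy b _ hb0
  refine ⟨y, ?_, by rw [sub_self, map_zero]; exact (Valuation.pos_iff _).mpr hb0⟩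
  -- `y^{p^n} ∈ K` and `K` perfect ⇒ `y ∈ K` (Frobenius is injective)
  induction n generalizing y with
  | zero => simpa using hy
  | succ n ih =>
    have h1 : (y ^ p) ^ p ^ n ∈ K := by rw [← pow_mul, ← pow_succ']; exact hy
    have h2 : y ^ p ∈ K := ih (y ^ p) h1
    obtain ⟨b, hbK, hb⟩ := hperf (y ^ p) h2
    have : b = y := by
      have h3 : (b - y) ^ p = 0 := by rw [sub_pow_char, hb, sub_self]
      exact sub_eq_zero.mp (pow_eq_zero_iff (Fact.out : p.Prime).ne_zero |>.mp h3)
    rw [← this]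
    exact hbK

end Elimination

/-! ### Lemma 4.2 over a ground field dense in its perfect hull, `z` of transcendental approximation type -/

section NormalForm

variable {p : ℕ} [Fact p.Prime] [CharP Ω p]

/-- **Kuhlmann 2019, Lemma 4.2 — the statement `(H42)` — over a ground field dense in its
perfect hull, for `z` of transcendental approximation type**: `lemma42_normalForm`
(`Kuhlmann2019Lemma42NormalForm.lean`) with "`K` separably closed" replaced by the two properties
of `K` its proof uses: density of `K` in its perfect hull (`hdense`, cf. the last assertion of the
printed Lemma 4.2: "If `(K,v)` is perfect or separably tame, we may assume that `K′ = K`") and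
the transcendental approximation type of `z` (`h3`, the standing assumption of §4.1, there
obtained from Lemma 4.6). For `z` transcendental over `K` with `(K(z)|K, V)` immediate and a
polynomial `f` over `K`: there are `c ∈ K`, `d ∈ K^×` with `v((z − c)/d) = 1`, a polynomial `g`
over `K` and `e ∈ K(z)^h` with `f(z) − g((z − c)/d) = e^p − e`, the non-zero coefficients `gᵢ`,
`i > 0`, having `p ∤ i` and pairwise distinct values. Same proof. [cite: Kuhlmann2019, Lemma 4.2] -/
theorem lemma42_normalForm_of_kaplansky [IsAlgClosed Ω] (K : Subfield Ω)
    (hdense : ∀ (y : Ω) (n : ℕ), y ^ p ^ n ∈ K → ∀ b ∈ K, b ≠ 0 →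
      ∃ β ∈ K, V.valuation (y - β) < V.valuation b)
    {z : Ω} (hz : Transcendental K z)
    (himm : IsImmediateOver V K (Subfield.closure ((K : Set Ω) ∪ {z})))
    (h3 : ∀ g : Polynomial Ω, (∀ k, g.coeff k ∈ K) → ∃ a₀ ∈ K, ∃ α : V.ValueGroup,
      ∀ a ∈ K, V.valuation (z - a) ≤ V.valuation (z - a₀) → V.valuation (g.eval a) = α)
    (f : Polynomial Ω) (hf : ∀ k, f.coeff k ∈ K) :
    ∃ c ∈ K, ∃ d ∈ K, d ≠ 0 ∧ V.valuation ((z - c) / d) = 1 ∧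
      ∃ g : Polynomial Ω, (∀ k, g.coeff k ∈ K) ∧
        (∃ e ∈ henselization V (Subfield.closure ((K : Set Ω) ∪ {z})),
          f.eval z - g.eval ((z - c) / d) = e ^ p - e) ∧
        (∀ i, 0 < i → g.coeff i ≠ 0 → ¬ p ∣ i) ∧
        (∀ i j, 0 < i → 0 < j → i ≠ j → g.coeff i ≠ 0 → g.coeff j ≠ 0 →
          V.valuation (g.coeff i) ≠ V.valuation (g.coeff j)) := by
  classical
  have hp : p.Prime := Fact.out
  set Kz : Subfield Ω := Subfield.closure ((K : Set Ω) ∪ {z}) with hKzdef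
  have hKKz : K ≤ Kz := fun c hc => Subfield.subset_closure (Or.inl hc)
  have hzKz : z ∈ Kz := Subfield.subset_closure (Or.inr rfl)
  ---------------------------------------------------------------- immediateness, transcendence
  have htrans : ∀ P : Polynomial Ω, (∀ k, P.coeff k ∈ K) → P.eval z = 0 → P = 0 := by
    intro P hP hPz
    obtain ⟨P', hP'⟩ : ∃ P' : Polynomial K, P'.map (algebraMap K Ω) = P :=
      (Polynomial.mem_lifts P).mp (mem_lifts_of_coeff_mem hP)
    by_contra hP0
    refine hz ⟨P', fun h => hP0 ?_, ?_⟩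
    · rw [← hP', h, Polynomial.map_zero]
    · rw [Polynomial.aeval_def, ← Polynomial.eval_map, hP', hPz]
  have hzK : z ∉ K := not_mem_of_forall_eval_eq_zero K htrans
  have hval : ∀ w ∈ Kz, w ≠ 0 → ∃ b ∈ K, V.valuation w = V.valuation b := himm.1
  have hres : ∀ w ∈ Kz, w ∈ V → ∃ c ∈ K, V.valuation (w - c) < 1 := by
    intro w hw hwV
    have hrw : residue V ⟨w, hwV⟩ ∈ resField V K := himm.2 (residue_mem_resField V ⟨w, hwV⟩ hw)
    obtain ⟨c, hcK, hcw⟩ := (mem_resField_iff V K _).mp hrw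
    refine ⟨c, hcK, ?_⟩
    have h0 : residue V (⟨w, hwV⟩ - c) = 0 := by rw [map_sub, hcw, sub_self]
    exact (ValuationSubring.valuation_lt_one_iff V (⟨w, hwV⟩ - c)).mp ((residue_eq_zero_iff _).mp h0)
  ---------------------------------------------------------------- the polynomials `P_j` ((4.9))
  set D : ℕ := f.natDegree with hDdef
  set Pj : ℕ → Polynomial Ω := fun j =>
    ∑ i ∈ pFiber p D j, hasseDeriv i f ^ p ^ (D - i.factorization p) with hPjdef
  have hPjK : ∀ j k, (Pj j).coeff k ∈ K := by
    intro j
    apply coeff_mem_of_mem_lifts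
    refine Subsemiring.sum_mem _ fun i _ => Subsemiring.pow_mem _ ?_ _
    exact mem_lifts_of_coeff_mem fun k => coeff_hasseDeriv_mem K hf i k
  set G : Finset (Polynomial Ω) := (pFreeIndices p D).image Pj with hGdef
  have hG : ∀ g ∈ G, ∀ k, g.coeff k ∈ K := by
    intro g hg k
    obtain ⟨j, -, rfl⟩ := Finset.mem_image.mp hg
    exact hPjK j k
  ---------------------------------------------------------------- the centre `a` and scale `b`
  obtain ⟨a, haK, b, hbK, hb0, hvb, hne⟩ :=
    exists_center_valuation_pow_ne V K hzK hval hres h3 G hG (D * p ^ D)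
  set zt : Ω := (z - a) / b with hztdef
  have hvb0 : V.valuation b ≠ 0 := (_root_.map_ne_zero _).mpr hb0
  have hzt1 : V.valuation zt = 1 := by
    rw [hztdef, map_div₀, ← hvb, div_self hvb0]
  have hztKz : zt ∈ Kz := div_mem (sub_mem hzKz (hKKz haK)) (hKKz hbK)
  have hbzt : b * zt = z - a := by rw [hztdef, mul_div_cancel₀ _ hb0]
  ---------------------------------------------------------------- the polynomial `B` in `z̃`
  set T : ℕ → Ω := fun i => (taylor a f).coeff i with hTdef
  have hTK : ∀ i, T i ∈ K := fun i => coeff_taylor_mem K hf haK i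
  have hT : ∀ i, T i = (hasseDeriv i f).eval a := fun i => taylor_coeff _ _ i
  set B : Polynomial Ω := ∑ i ∈ Finset.range (D + 1), C (T i * b ^ i) * X ^ i with hBdef
  have hBcoeff : ∀ k, B.coeff k = if k ∈ Finset.range (D + 1) then T k * b ^ k else 0 := by
    intro k
    rw [hBdef, finsetSum_coeff]
    have h1 : ∀ i ∈ Finset.range (D + 1), (C (T i * b ^ i) * X ^ i).coeff k =
        if k = i then T i * b ^ i else 0 := by
      intro i _
      rw [coeff_C_mul, coeff_X_pow, mul_ite, mul_one, mul_zero]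
    rw [Finset.sum_congr rfl h1, Finset.sum_ite_eq]
  have hB : ∀ k, B.coeff k ∈ K := by
    intro k
    rw [hBcoeff]
    split_ifs
    · exact mul_mem (hTK k) (pow_mem hbK k)
    · exact K.zero_mem
  have hBdeg : B.natDegree ≤ D := by
    rw [natDegree_le_iff_coeff_eq_zero]
    intro k hk
    rw [hBcoeff, if_neg]
    rw [Finset.mem_range]
    omega
  have hBeval : B.eval zt = f.eval z := by
    have h1 : f.eval z = (taylor a f).eval (z - a) := by rw [taylor_eval, sub_add_cancel]
    have hdegT : (taylor a f).natDegree < D + 1 := by rw [natDegree_taylor]; omega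
    rw [h1, eval_eq_sum_range' hdegT, hBdef, eval_finsetSum]
    refine Finset.sum_congr rfl fun i _ => ?_
    rw [eval_mul, eval_C, eval_pow, eval_X, ← hbzt, mul_pow, mul_assoc]
  ---------------------------------------------------------------- elimination in `F = K(z)^h`
  set F : Subfield Ω := henselization V Kz with hFdef
  have hKzF : Kz ≤ F := le_henselization V Kz
  have hFh : IsHenselianField F (V.comap (algebraMap F Ω)) :=
    Kuhlmann2010HenselizationIsHenselian_holds Ω V Kz
  have hF : HenselianLocalRing (V.comap (algebraMap F Ω)) := Kuhlmann2010HenselsLemma_holds _ _ hFh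
  obtain ⟨g, hg, -, ⟨e, heF, hcong⟩, hpdiv, hvals⟩ :=
    exists_pElimination_of_dense V (hKKz.trans hKzF) hdense hF (hKzF hztKz) hzt1.le hB hBdeg
  ---------------------------------------------------------------- `S_i^{p^D} = b^{i p^D} P_i(a)`
  have hSpow : ∀ i, 0 < i → i ≤ D →
      pRootSum p B D i ^ p ^ D = b ^ (i * p ^ D) * (Pj i).eval a := by
    intro i hi hiD
    rw [pRootSum_pow, hPjdef]
    simp only
    rw [eval_finsetSum, Finset.mul_sum]
    refine Finset.sum_congr rfl fun k hk => ?_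
    obtain ⟨⟨hk0, hkD⟩, hki⟩ := mem_pFiber_iff.mp hk
    have hν : k.factorization p ≤ D := (factorization_le_of_pos hp hk0).trans hkD
    have hkmem : k ∈ Finset.range (D + 1) := Finset.mem_range.mpr (Nat.lt_succ_of_le hkD)
    have hexp : k * p ^ (D - k.factorization p) = i * p ^ D := by
      have h1 := pow_factorization_mul_pFreePart (p := p) k
      rw [hki] at h1
      calc k * p ^ (D - k.factorization p)
          = p ^ k.factorization p * i * p ^ (D - k.factorization p) := by rw [h1]
        _ = i * (p ^ k.factorization p * p ^ (D - k.factorization p)) := by ring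
        _ = i * p ^ D := by rw [← pow_add, Nat.add_sub_cancel' hν]
    rw [hBcoeff, if_pos hkmem, eval_pow, ← hT, mul_pow, ← pow_mul, hexp]
    ring
  ---------------------------------------------------------------- conclusion
  refine ⟨a, haK, b, hbK, hb0, hzt1, g, hg, ⟨e, heF, ?_⟩, ?_, ?_⟩
  · rw [← hBeval]
    exact hcong
  · intro i hi hgi hpi
    exact hgi (hpdiv i hi hpi)
  · intro i j hi hj hij hgi hgj heq
    -- `i, j ≤ D`, prime to `p`, with `S ≠ 0` and `v(g) = v(S)`
    have hpi : ¬ p ∣ i := fun h => hgi (hpdiv i hi h)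
    have hpj : ¬ p ∣ j := fun h => hgj (hpdiv j hj h)
    have hiD : i ≤ D := by
      by_contra hlt
      push Not at hlt
      exact hgi ((hvals i hi hpi).1 (pRootSum_eq_zero_of_lt hlt))
    have hjD : j ≤ D := by
      by_contra hlt
      push Not at hlt
      exact hgj ((hvals j hj hpj).1 (pRootSum_eq_zero_of_lt hlt))
    have hSi : pRootSum p B D i ≠ 0 := fun h0 => hgi ((hvals i hi hpi).1 h0)
    have hSj : pRootSum p B D j ≠ 0 := fun h0 => hgj ((hvals j hj hpj).1 h0)
    have hvi : V.valuation (g.coeff i) = V.valuation (pRootSum p B D i) := (hvals i hi hpi).2 hSi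
    have hvj : V.valuation (g.coeff j) = V.valuation (pRootSum p B D j) := (hvals j hj hpj).2 hSj
    -- `P_i(a), P_j(a) ≠ 0`
    have hPi0 : (Pj i).eval a ≠ 0 := by
      intro h0
      have := hSpow i hi hiD
      rw [h0, mul_zero] at this
      exact pow_ne_zero _ hSi this
    have hPj0 : (Pj j).eval a ≠ 0 := by
      intro h0
      have := hSpow j hj hjD
      rw [h0, mul_zero] at this
      exact pow_ne_zero _ hSj this
    have hPiG : Pj i ∈ G := Finset.mem_image.mpr ⟨i, mem_pFreeIndices_iff.mpr ⟨⟨hi, hiD⟩, hpi⟩, rfl⟩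
    have hPjG : Pj j ∈ G := Finset.mem_image.mpr ⟨j, mem_pFreeIndices_iff.mpr ⟨⟨hj, hjD⟩, hpj⟩, rfl⟩
    have hmm : i * p ^ D ≠ j * p ^ D := fun h =>
      hij (Nat.eq_of_mul_eq_mul_right (pow_pos hp.pos D) h)
    refine hne (Pj i) hPiG (Pj j) hPjG (i * p ^ D) (j * p ^ D)
      (Nat.mul_le_mul_right _ hiD) (Nat.mul_le_mul_right _ hjD) hmm hPi0 hPj0 ?_
    -- from `v(S_i) = v(S_j)`
    have h1 : V.valuation (pRootSum p B D i) ^ p ^ D = V.valuation (pRootSum p B D j) ^ p ^ D := by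
      rw [← hvi, ← hvj, heq]
    rw [← map_pow, ← map_pow, hSpow i hi hiD, hSpow j hj hjD, map_mul, map_mul, map_pow,
      map_pow] at h1
    rw [mul_comm (V.valuation ((Pj i).eval a)), mul_comm (V.valuation ((Pj j).eval a))]
    exact h1


end NormalForm

/-! ### (4.3): an Artin–Schreier generator with polynomial right-hand side -/

section Generator

variable [IsAlgClosed Ω]

/-- **Kuhlmann 2019, §4, (4.3), for `z` of transcendental approximation type** —
`exists_artinSchreier_generator_eval` (`Kuhlmann2019Prop48Setup.lean`) with "`K` separably closed
of rank one" replaced by what its proof uses: the transcendental approximation type `h3` of `z`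
and rank one of `K(z)` (Lemma 4.1, `exists_polynomial_valuation_sub_lt_one_of_mem_henselization`).
For `z` transcendental over `K` with `(K(z)|K, V)` immediate and a Galois extension `E` of degree
`p` of `K(z)^h`: `E = K(z)^h(ϑ)` with `ϑ^p − ϑ = f(z)`, `f` a polynomial over `K`. Same proof.
[cite: Kuhlmann2019, Section 4, (4.3)] -/
theorem exists_artinSchreier_generator_eval_of_kaplansky {p : ℕ} [Fact p.Prime] [CharP Ω p]
    (K : Subfield Ω) {z : Ω} (hz : Transcendental K z)
    (himm : IsImmediateOver V K (Subfield.closure ((K : Set Ω) ∪ {z})))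
    (h3 : ∀ g : Polynomial Ω, (∀ k, g.coeff k ∈ K) → ∃ a₀ ∈ K, ∃ α : V.ValueGroup,
      ∀ a ∈ K, V.valuation (z - a) ≤ V.valuation (z - a₀) → V.valuation (g.eval a) = α)
    (hr1 : IsRankOneValued V (Subfield.closure ((K : Set Ω) ∪ {z})))
    {E : Subfield Ω} (hE : IsGaloisStep p (henselization V (Subfield.closure ((K : Set Ω) ∪ {z}))) E) :
    ∃ ϑ ∈ E, ∃ f : Polynomial Ω, (∀ k, f.coeff k ∈ K) ∧ ϑ ^ p - ϑ = f.eval z ∧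
      E = Subfield.closure
        ((henselization V (Subfield.closure ((K : Set Ω) ∪ {z})) : Set Ω) ∪ {ϑ}) := by
  classical
  have hp : p.Prime := Fact.out
  set Kz : Subfield Ω := Subfield.closure ((K : Set Ω) ∪ {z}) with hKzdef
  set L : Subfield Ω := henselization V Kz with hLdef
  have hKKz : K ≤ Kz := fun c hc => Subfield.subset_closure (Or.inl hc)
  have hzKz : z ∈ Kz := Subfield.subset_closure (Or.inr rfl)
  have hKzL : Kz ≤ L := le_henselization V Kz
  haveI : CharP L p := (algebraMap L Ω).charP Subtype.val_injective p
  -- the Galois step as an intermediate field over `L`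
  obtain ⟨hle, hdeg, hgal⟩ := hE
  haveI := hgal
  haveI : FiniteDimensional L (Subfield.extendScalars hle) :=
    Module.finite_of_finrank_pos (by rw [hdeg]; exact hp.pos)
  -- Artin–Schreier generator `ϑ₀`, `ϑ₀^p − ϑ₀ = a ∈ L`
  obtain ⟨ϑ₀, hϑ₀E, ⟨a, ha⟩, hgen⟩ :=
    Literature.FieldTheory.ArtinSchreier.IntermediateField.exists_generator_pow_sub_self_mem
      (Subfield.extendScalars hle) hdeg
  have hϑ₀E' : ϑ₀ ∈ E := hϑ₀E
  have haL : (a : Ω) ∈ L := a.2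
  have ha' : (a : Ω) = ϑ₀ ^ p - ϑ₀ := ha
  -- transcendence in polynomial form, `z ∉ K`; immediateness as `hval`, `hres`
  have htrans : ∀ P : Polynomial Ω, (∀ k, P.coeff k ∈ K) → P.eval z = 0 → P = 0 := by
    intro P hP hPz
    obtain ⟨P', hP'⟩ : ∃ P' : Polynomial K, P'.map (algebraMap K Ω) = P :=
      (Polynomial.mem_lifts P).mp (mem_lifts_of_coeff_mem hP)
    by_contra hP0
    refine hz ⟨P', fun h => hP0 ?_, ?_⟩
    · rw [← hP', h, Polynomial.map_zero]
    · rw [Polynomial.aeval_def, ← Polynomial.eval_map, hP', hPz]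
  have hzK : z ∉ K := not_mem_of_forall_eval_eq_zero K htrans
  have hval : ∀ w ∈ Kz, w ≠ 0 → ∃ b ∈ K, V.valuation w = V.valuation b := himm.1
  have hres : ∀ w ∈ Kz, w ∈ V → ∃ c ∈ K, V.valuation (w - c) < 1 := by
    intro w hw hwV
    have hrw : residue V ⟨w, hwV⟩ ∈ resField V K := himm.2 (residue_mem_resField V ⟨w, hwV⟩ hw)
    obtain ⟨c, hcK, hcw⟩ := (mem_resField_iff V K _).mp hrw
    refine ⟨c, hcK, ?_⟩
    have h0 : residue V (⟨w, hwV⟩ - c) = 0 := by rw [map_sub, hcw, sub_self]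
    exact (ValuationSubring.valuation_lt_one_iff V (⟨w, hwV⟩ - c)).mp ((residue_eq_zero_iff _).mp h0)
  -- Lemma 4.1: `a = f(z) + m`, `v(m) < 1`
  obtain ⟨f, hf, hvm⟩ :=
    exists_polynomial_valuation_sub_lt_one_of_mem_henselization V K hzK hval hres h3 hr1 haL
  have hfzL : f.eval z ∈ L := hKzL (eval_mem_subfield_of_coeff_mem (fun k => hKKz (hf k)) hzKz)
  have hmL : (a : Ω) - f.eval z ∈ L := sub_mem haL hfzL
  -- Hensel: `m = d^p − d`, `d ∈ L`
  have hLh : IsHenselianField L (V.comap (algebraMap L Ω)) :=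
    Kuhlmann2010HenselizationIsHenselian_holds Ω V Kz
  have hH : HenselianLocalRing (V.comap (algebraMap L Ω)) := Kuhlmann2010HenselsLemma_holds _ _ hLh
  obtain ⟨d, hdL, hdeq, -⟩ := exists_artinSchreierRoot_of_valuation_lt_one hH hmL hvm
  -- the new generator `ϑ = ϑ₀ − d`
  refine ⟨ϑ₀ - d, sub_mem hϑ₀E' (hle hdL), f, hf, ?_, ?_⟩
  · rw [sub_pow_char]
    have h1 : ϑ₀ ^ p - d ^ p - (ϑ₀ - d) = (ϑ₀ ^ p - ϑ₀) - (d ^ p - d) := by ring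
    rw [h1, ← ha', hdeq]
    ring
  · -- `L⟮ϑ₀ − d⟯ = L⟮ϑ₀⟯ = E`
    have hadj : L⟮ϑ₀ - d⟯ = Subfield.extendScalars hle := by
      have h := Literature.FieldTheory.ArtinSchreier.adjoin_simple_sub_algebraMap (F := L) (E := Ω)
        ϑ₀ ⟨d, hdL⟩
      rw [← hgen, ← h]
      rfl
    have h2 := congrArg IntermediateField.toSubfield hadj
    rw [Subfield.extendScalars_toSubfield, adjoin_toSubfield_eq_closure] at h2
    exact h2.symm


end Generator

/-! ### Prop. 4.8 over a ground field algebraically closed in the step -/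

section DegreePStep

variable [IsAlgClosed Ω]

/-- **Kuhlmann 2019, Prop. 4.8, for `z` of transcendental approximation type and `K`
algebraically closed in `E`** — `prop48_of_normalForm` (`Kuhlmann2019DegreePStepAssembly.lean`)
with "`K` separably closed" replaced by what its proof uses: the transcendental approximation
type `h3` of `z` (for (4.3)), the normal form `(H42)` of Lemma 4.2 for this `z`, and — for the
case of a CONSTANT normal form `ϑ'^p − ϑ' = a₀ ∈ K`, where the printed proof needs `ϑ' ∈ K` —
that every element of `E` algebraic over `K` lies in `K` (Temkin's `k`-splitness of the analytic
field, Temkin 2013, Cor. 3.1.10; [temst] = M. Temkin, *Stable modification of relative curves*,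
J. Algebraic Geom. 19 (2010), proof of Thm. 6.3.1, last paragraph). For `K ≤ Ω` of rank one
(characteristic `p`), `z` transcendental with `(K(z)|K, V)` immediate, and `E` a Galois extension
of degree `p` of `K(z)^h`: `E = K(ϑ)^h` for some `ϑ ∈ E`. Same proof otherwise ((4.3), Lemma 4.7).
[cite: Kuhlmann2019, Prop. 4.8] -/
theorem prop48_of_kaplansky {p : ℕ} [Fact p.Prime] [CharP Ω p] [CharP (ResidueField V) p]
    (K : Subfield Ω) (hr : IsRankOne V K) {z : Ω} (hz : Transcendental K z)
    (himm : IsImmediateOver V K (Subfield.closure ((K : Set Ω) ∪ {z})))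
    (h3 : ∀ g : Polynomial Ω, (∀ k, g.coeff k ∈ K) → ∃ a₀ ∈ K, ∃ α : V.ValueGroup,
      ∀ a ∈ K, V.valuation (z - a) ≤ V.valuation (z - a₀) → V.valuation (g.eval a) = α)
    (H42 : ∀ f : Polynomial Ω, (∀ k, f.coeff k ∈ K) →
      ∃ c ∈ K, ∃ d ∈ K, d ≠ 0 ∧ V.valuation ((z - c) / d) = 1 ∧
      ∃ g : Polynomial Ω, (∀ k, g.coeff k ∈ K) ∧
        (∃ e ∈ henselization V (Subfield.closure ((K : Set Ω) ∪ {z})),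
          f.eval z - g.eval ((z - c) / d) = e ^ p - e) ∧
        (∀ i, 0 < i → g.coeff i ≠ 0 → ¬ p ∣ i) ∧
        (∀ i j, 0 < i → 0 < j → i ≠ j → g.coeff i ≠ 0 → g.coeff j ≠ 0 →
          V.valuation (g.coeff i) ≠ V.valuation (g.coeff j)))
    {E : Subfield Ω} (hE : IsGaloisStep p (henselization V (Subfield.closure ((K : Set Ω) ∪ {z}))) E)
    (hrel : ∀ a ∈ E, IsAlgebraic K a → a ∈ K) :
    ∃ ϑ ∈ E, E = henselization V (Subfield.closure ((K : Set Ω) ∪ {ϑ})) := by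
  classical
  have hp : p.Prime := Fact.out
  set Kz : Subfield Ω := Subfield.closure ((K : Set Ω) ∪ {z}) with hKzdef
  set L : Subfield Ω := henselization V Kz with hLdef
  have hKKz : K ≤ Kz := fun c hc => Subfield.subset_closure (Or.inl hc)
  have hzKz : z ∈ Kz := Subfield.subset_closure (Or.inr rfl)
  have hKzL : Kz ≤ L := le_henselization V Kz
  obtain ⟨hle, hdeg, -⟩ := id hE
  have hfin : 0 < Subfield.relfinrank L E := by
    rw [Subfield.relfinrank_eq_finrank_of_le hle, hdeg]
    exact hp.pos
  -- rank one of `K(z)`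
  have hr1 : IsRankOneValued V Kz :=
    (isRankOneValued_of_overrings V K hr.1 hr.2).of_isImmediateOver hKKz himm
  -- (4.3): an Artin–Schreier generator with polynomial right-hand side
  obtain ⟨ϑ, hϑE, f, hf, hϑeq, hEgen⟩ :=
    exists_artinSchreier_generator_eval_of_kaplansky V K hz himm h3 hr1 hE
  -- Lemma 4.2: the normal form
  obtain ⟨c, hcK, d, hdK, hd0, hvzt, g, hg, ⟨e, heL, hfg⟩, hcond, hdist⟩ := H42 f hf
  set zt : Ω := (z - c) / d with hztdef
  -- the new generator `ϑ' = ϑ − e`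
  set ϑ' : Ω := ϑ - e with hϑ'def
  have hϑ'E : ϑ' ∈ E := sub_mem hϑE (hle heL)
  have hϑ'eq : ϑ' ^ p - ϑ' = g.eval zt := by
    rw [hϑ'def, sub_pow_char]
    have h1 : ϑ ^ p - e ^ p - (ϑ - e) = (ϑ ^ p - ϑ) - (e ^ p - e) := by ring
    rw [h1, hϑeq, ← hfg]
    ring
  have hEgen' : E = Subfield.closure ((L : Set Ω) ∪ {ϑ'}) := by
    rw [hEgen]
    have h1 : L⟮ϑ - e⟯ = L⟮ϑ⟯ :=
      Literature.FieldTheory.ArtinSchreier.adjoin_simple_sub_algebraMap (F := L) (E := Ω) ϑ ⟨e, heL⟩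
    have h2 := congrArg IntermediateField.toSubfield h1
    rw [adjoin_toSubfield_eq_closure, adjoin_toSubfield_eq_closure] at h2
    exact h2.symm
  -- `K(z̃) = K(z)`
  have hKzt : Subfield.closure ((K : Set Ω) ∪ {zt}) = Kz := by
    apply le_antisymm
    · refine Subfield.closure_le.mpr (Set.union_subset hKKz (Set.singleton_subset_iff.mpr ?_))
      exact div_mem (sub_mem hzKz (hKKz hcK)) (hKKz hdK)
    · refine Subfield.closure_le.mpr (Set.union_subset
        (fun b hb => Subfield.subset_closure (Or.inl hb)) (Set.singleton_subset_iff.mpr ?_))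
      have hz' : z = d * zt + c := by
        rw [hztdef]
        field_simp
        ring
      rw [hz']
      exact add_mem (mul_mem (Subfield.subset_closure (Or.inl hdK))
        (Subfield.subset_closure (Or.inr rfl))) (Subfield.subset_closure (Or.inl hcK))
  -- `g(z̃) = ϑ'^p − ϑ' ∈ K(ϑ')`
  have hgθ : g.eval zt ∈ Subfield.closure ((K : Set Ω) ∪ {ϑ'}) := by
    rw [← hϑ'eq]
    have hm : ϑ' ∈ Subfield.closure ((K : Set Ω) ∪ {ϑ'}) := Subfield.subset_closure (Or.inr rfl)
    exact sub_mem (pow_mem hm p) hm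
  -- `g` is not constant (else `ϑ' ∈ E` would be algebraic over `K`, i.e. in `K`)
  have hnc : ∃ i, 0 < i ∧ g.coeff i ≠ 0 := by
    by_contra hall
    push Not at hall
    have hg0 : g.eval zt = g.coeff 0 := by
      rw [eval_eq_sum_range, Finset.sum_range_succ', pow_zero, mul_one,
        Finset.sum_eq_zero fun k _ => by rw [hall (k + 1) (Nat.succ_pos k), zero_mul], zero_add]
    have hϑ'K : ϑ' ∈ K := by
      haveI : CharP K p := (algebraMap K Ω).charP Subtype.val_injective p
      set a₀ : K := ⟨g.coeff 0, hg 0⟩ with ha₀def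
      set P : Polynomial K := X ^ p - X - C a₀ with hPdef
      have hder : derivative P = -1 := by
        rw [hPdef, derivative_sub, derivative_sub, derivative_X_pow, derivative_X, derivative_C,
          CharP.cast_eq_zero K p, C_0, zero_mul, zero_sub, sub_zero]
      have hPϑ : aeval ϑ' P = 0 := by
        rw [hPdef, map_sub, map_sub, map_pow, aeval_X, aeval_C, hϑ'eq, hg0]
        exact sub_self _
      have hP0 : P ≠ 0 := fun h0 => by
        have := congrArg derivative h0
        rw [hder, derivative_zero] at this
        exact neg_ne_zero.mpr one_ne_zero this
      exact hrel ϑ' hϑ'E ⟨P, hP0, hPϑ⟩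
    have hEL : E = L := by
      rw [hEgen']
      exact le_antisymm (Subfield.closure_le.mpr (Set.union_subset le_rfl
        (Set.singleton_subset_iff.mpr (hKzL (hKKz hϑ'K)))))
        (fun b hb => Subfield.subset_closure (Or.inl hb))
    have h1 : Subfield.relfinrank L E = 1 := by rw [hEL, Subfield.relfinrank_self]
    rw [Subfield.relfinrank_eq_finrank_of_le hle, hdeg] at h1
    exact hp.one_lt.ne' h1
  -- the dominant index `i₀`
  set S : Finset ℕ := (Finset.range (g.natDegree + 1)).filter fun i => 0 < i ∧ g.coeff i ≠ 0
    with hSdef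
  have hSmem : ∀ i, 0 < i → g.coeff i ≠ 0 → i ∈ S := fun i hi hgi =>
    Finset.mem_filter.mpr ⟨Finset.mem_range.mpr (Nat.lt_succ_of_le (le_natDegree_of_ne_zero hgi)),
      hi, hgi⟩
  have hSne : S.Nonempty := by
    obtain ⟨i, hi, hgi⟩ := hnc
    exact ⟨i, hSmem i hi hgi⟩
  obtain ⟨i₀, hi₀S, hmax⟩ := Finset.exists_max_image S (fun i => V.valuation (g.coeff i)) hSne
  obtain ⟨-, hi₀, ha⟩ := Finset.mem_filter.mp hi₀S
  have hpi₀ : (i₀ : ResidueField V) ≠ 0 := by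
    rw [Ne, CharP.cast_eq_zero_iff (ResidueField V) p]
    exact hcond i₀ hi₀ ha
  have hdom : ∀ i, 0 < i → i ≠ i₀ → V.valuation (g.coeff i) < V.valuation (g.coeff i₀) := by
    intro i hi hii
    by_cases hgi : g.coeff i = 0
    · rw [hgi, map_zero]
      exact (Valuation.pos_iff _).mpr ha
    · exact lt_of_le_of_ne (hmax i (hSmem i hi hgi)) (hdist i i₀ hi hi₀ hii hgi ha)
  exact ⟨ϑ', hϑ'E, eq_henselization_of_generator V K himm hle hfin hϑ'E hEgen' hvzt hKzt hg hgθ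
    hi₀ hpi₀ ha hdom⟩


end DegreePStep

/-! ### The degree-`p` step over a perfect henselian ground field of rank one, inside a split `Φ` -/

section Perfect

variable [IsAlgClosed Ω]

/-- **The degree-`p` step of Temkin 2013, Thm. 3.2.3 / [temst] Thm. 6.3.1 in Kuhlmann's form:
Prop. 4.8 over a PERFECT henselian ground field of rank one, inside a split extension.** Let `Ω`
be algebraically closed of characteristic `p` with valuation ring `V` (residue characteristic
`p`), `K ≤ Ω` perfect, henselian, of rank one (`IsRankOne`), `z` transcendental over `K` with
`(K(z)|K, V)` immediate, `Φ ≥ K(z)` a henselian subfield in which `K` is algebraically closed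
(every element of `Φ` algebraic over `K` lies in `K` — by Temkin 2013, Cor. 3.1.10,
`DeeplyRamifiedSplit.lean`, `Φ` is then `K`-split), and `E ≤ Φ` a Galois extension of degree `p`
of `K(z)^h`. Then `E = K(ϑ)^h` for some `ϑ ∈ E`. PROVED: splitness gives the transcendental
approximation type of `z` (`kaplansky_condition_of_split`, `SplitApproximationType.lean`),
perfectness the density hypothesis (`dense_of_perfect`), so Lemma 4.2
(`lemma42_normalForm_of_kaplansky`) and Prop. 4.8 (`prop48_of_kaplansky`) apply.
[cite: Kuhlmann2019, Prop. 4.8] [cite: Temkin2013, Thm. 3.2.3 (proof, Step 1)] -/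
theorem prop48_of_perfect (p : ℕ) [Fact p.Prime] [CharP Ω p] [CharP (ResidueField V) p]
    (K : Subfield Ω) (hK : IsHenselianField K (V.comap (algebraMap K Ω)))
    (hperf : ∀ y ∈ K, ∃ b ∈ K, b ^ p = y) (hr : IsRankOne V K)
    {z : Ω} (hz : Transcendental K z)
    (himm : IsImmediateOver V K (Subfield.closure ((K : Set Ω) ∪ {z})))
    {Φ : Subfield Ω} (hΦ : IsHenselianField Φ (V.comap (algebraMap Φ Ω))) (hzΦ : z ∈ Φ)
    (hKΦ : K ≤ Φ) (hrelΦ : ∀ a ∈ Φ, IsAlgebraic K a → a ∈ K)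
    {E : Subfield Ω} (hE : IsGaloisStep p (henselization V (Subfield.closure ((K : Set Ω) ∪ {z}))) E)
    (hEΦ : E ≤ Φ) :
    ∃ ϑ ∈ E, E = henselization V (Subfield.closure ((K : Set Ω) ∪ {ϑ})) := by
  have hr1 : IsRankOneValued V K := isRankOneValued_of_overrings V K hr.1 hr.2
  -- transcendence in polynomial form
  have htrans : ∀ P : Polynomial Ω, (∀ k, P.coeff k ∈ K) → P.eval z = 0 → P = 0 := by
    intro P hP hPz
    obtain ⟨P', hP'⟩ : ∃ P' : Polynomial K, P'.map (algebraMap K Ω) = P :=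
      (Polynomial.mem_lifts P).mp (mem_lifts_of_coeff_mem hP)
    by_contra hP0
    refine hz ⟨P', fun h => hP0 ?_, ?_⟩
    · rw [← hP', h, Polynomial.map_zero]
    · rw [Polynomial.aeval_def, ← Polynomial.eval_map, hP', hPz]
  -- `Φ` is `K`-split (Temkin 2013, Cor. 3.1.10), in particular at `z`
  have hsplit : ∀ θ g : Ω, IsAlgebraic K θ → IsAlgebraic K g →
      (∀ c ∈ K, V.valuation g ≤ V.valuation (z - c)) → V.valuation g ≤ V.valuation (z - θ) :=
    fun θ g hθ hg hfar =>
      valuation_le_sub_of_forall_isAlgebraic_mem_of_perfect V p hKΦ hK hperf hr1 hΦ hrelΦ hzΦ hθ hg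
        hfar
  -- hence `z` has transcendental approximation type
  have h3 := kaplansky_condition_of_split V K htrans himm hsplit
  exact prop48_of_kaplansky V K hr hz himm h3
    (fun f hf => lemma42_normalForm_of_kaplansky V K (dense_of_perfect V hperf) hz himm h3 f hf) hE
    fun a ha halg => hrelΦ a (hEΦ ha) halg

end Perfect

end Literature.AlgebraicGeometry.Resolution
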